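import Literature.Computability.AlgebraicComplexity.LaserMethodValues
import Literature.Computability.AlgebraicComplexity.LaserSymmetrizationEntropy
import HarnessLib

/-!
# The laser method with values, symmetrised form: Le Gall 2014, Thm. 4.1 as printed
(`∑_ℓ H(P_ℓ)/3`, for the value defined through `t ⊗ t_C ⊗ t_{C²}`) — proved

Topic `Literature/Computability/AlgebraicComplexity`.  F. Le Gall, *Powers of tensors and fast
matrix multiplication* (ISSAC 2014, arXiv:1401.7714), Thm. 4.1 (p. 6):

> Let `t` be a trilinear form, and `D` be a decomposition of `t` with tight support `S` and
> component set `{t(s)}_{s∈S}`. Then, for any `P ∈ D(S)` and any `ρ ∈ [2,3]`,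
> `log(V_ρ(t)) ≥ ∑_{ℓ=1}^{3} H(P_ℓ)/3 + ∑_{s∈S} P(s) log(V_ρ(t(s))) − Γ_S(P)`,

where Le Gall's value `V_ρ` (Def. 2.1) is defined through degenerations of powers of the
symmetrised tensor `t ⊗ t_C ⊗ t_{C²}`; in the tree's predicate form (`HasLaserValue`,
`LaserValue.lean`; `symm3`, `LaserSymmetrization.lean`) "`V_ρ(t) ≥ v`" in Le Gall's sense is
`HasLaserValue ρ (symm3 t) (v³)`.  The tree's `laserMethod_hasLaserValue` (`LaserMethodValues.lean`)
is the un-symmetrised `min_m H(P_m)` form; this file PROVES the printed form by running that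
theorem's core (`laserMethod_hasLaserValue_of_blockValue`) on the decomposition of
`t ⊗ t_C ⊗ t_{C²}` induced by `D` (Le Gall, Appendix A.3: support `Λ`, distribution `P ⊗ P ⊗ P`,
whose three marginal entropies all equal `H(P₁)+H(P₂)+H(P₃)` and whose penalty is `≤ 3 Γ_S(P)`,
`LaserSymmetrizationEntropy.lean`), the blocks of one joint type being
`t^{⊗N}(a,b,c) ⊗ t_C^{⊗N}(b',c',a') ⊗ t_{C²}^{⊗N}(c'',a'',b'') ≅ ⊗_s (t(s) ⊗ t(s)_C ⊗ t(s)_{C²})^{⊗ N P(s)}`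
(Le Gall (6) and the sentence after (8): "since the value is supermultiplicative and invariant
under permutation of coordinates"):

* `laserMethodSym_hasLaserValue` — **Thm. 4.1**: `S` `b`-tight, `V_ρ(t(s)) ≥ u(s) > 0` in Le Gall's
  sense (`HasLaserValue ρ (symm3 (t(s))) (u(s)³)`) for `s ∈ S` ⇒ for every distribution `P` on `S`,
  `HasLaserValue ρ (symm3 t) (2^{∑_ℓ H(P_ℓ) − 3Γ_S(P)} (∏_s u(s)^{P(s)})³)`, i.e.
  `log₂ V_ρ(t) ≥ ∑_ℓ H(P_ℓ)/3 + ∑_s P(s) log₂ u(s) − Γ_S(P)` for Le Gall's `V_ρ`.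
* `omega_le_of_laserMethodSym` — with Thm. 2.2: if that bound exceeds `R̃(t)³` (`≥ R̃(t⊗t_C⊗t_{C²})`)
  then `ω ≤ ρ`.
* `hasLaserValue_symm3_matMulTensor` — `V_ρ(⟨k,m,n⟩) ≥ (kmn)^{ρ/3}` in Le Gall's sense
  (`t_C`, `t_{C²}` of a matrix tensor are matrix tensors), the value of matrix components.
* Tools: `letterCount_comp_equiv`, `symCounts` (the count vector of `P ⊗ P ⊗ P`) and the type
  computations `letterCount_proj₁₂₃_of_symCounts`, `hasLaserValue_laserBlock_symm3` (the block
  value system of the induced decomposition, fed to the core).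

Everything is proved; one definition (`symCounts`); no named facts.

## References

* F. Le Gall, ISSAC 2014, arXiv:1401.7714 (held: `paper:arxiv-1401.7714`): Def. 2.1, Thm. 2.2,
  Thm. 4.1, Appendix A.3 (Eqs. (4)–(8), pp. 21–24). [LeGall2014]
* D. Coppersmith, S. Winograd, J. Symbolic Comput. 9 (1990), §8 (the symmetrised value of the
  component `[112]` of `CW_q^{⊗2}`). [CoppersmithWinograd1990]
-/

noncomputable section

open scoped BigOperators
open Finset Filter Topology

namespace Literature.Computability.AlgebraicComplexity

universe u

/-! ## Words over the induced labels: counts and types -/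

section Counts

variable {I J L : Type*}

/-- **The count vector of `P ⊗ P ⊗ P`**: `(X,Y,Z) ↦ c(s¹) c(s²) c(s³)`. [cite: LeGall2014, Appendix A.3] -/
def symCounts (c : I × J × L → ℕ) : (I × J × L) × (J × L × I) × (L × I × J) → ℕ :=
  fun XYZ => c (symLabelEquiv I J L XYZ).1 * c (symLabelEquiv I J L XYZ).2.1 *
    c (symLabelEquiv I J L XYZ).2.2

/-- `symCounts` through `symLabelEquiv`. [folklore] -/
theorem symCounts_symm_apply (c : I × J × L → ℕ) (T : (I × J × L) × (I × J × L) × (I × J × L)) :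
    symCounts c ((symLabelEquiv I J L).symm T) = c T.1 * c T.2.1 * c T.2.2 := by
  simp only [symCounts, Equiv.apply_symm_apply]

variable [Fintype I] [Fintype J] [Fintype L] [DecidableEq I] [DecidableEq J] [DecidableEq L]

/-- Relabelling the alphabet along a bijection relabels the type. [folklore] -/
theorem letterCount_comp_equiv {A B : Type*} [DecidableEq A] [DecidableEq B] {N : ℕ} (e : A ≃ B)
    (w : Fin N → A) (b : B) : letterCount (fun q => e (w q)) b = letterCount w (e.symm b) := by
  simp only [letterCount_apply]
  congr 1
  ext q
  simp only [Finset.mem_filter, Finset.mem_univ, true_and]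
  exact Equiv.apply_eq_iff_eq_symm_apply e

omit [DecidableEq I] [DecidableEq J] [DecidableEq L] in
/-- `∑ symCounts c = (∑ c)³`. [folklore] -/
theorem sum_symCounts (c : I × J × L → ℕ) : ∑ XYZ, symCounts c XYZ = (∑ s, c s) ^ 3 := by
  rw [← Equiv.sum_comp (symLabelEquiv I J L).symm]
  simp only [symCounts_symm_apply]
  rw [sum_prod3]; ring

/-- `symCounts c` vanishes off the induced support of any `S ⊇ supp c`. [folklore] -/
theorem symCounts_eq_zero {S : Finset (I × J × L)} {c : I × J × L → ℕ} (hcS : ∀ s, s ∉ S → c s = 0)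
    (XYZ : (I × J × L) × (J × L × I) × (L × I × J)) (h : XYZ ∉ symSupport S) : symCounts c XYZ = 0 := by
  rw [mem_symSupport] at h
  simp only [symCounts]
  by_cases h1 : (symLabelEquiv I J L XYZ).1 ∈ S
  · by_cases h2 : (symLabelEquiv I J L XYZ).2.1 ∈ S
    · have h3 : (symLabelEquiv I J L XYZ).2.2 ∉ S := fun h3 => h ⟨h1, h2, h3⟩
      rw [hcS _ h3, mul_zero]
    · rw [hcS _ h2, mul_zero, zero_mul]
  · rw [hcS _ h1, zero_mul, zero_mul]

omit [Fintype I] [Fintype J] [Fintype L] [DecidableEq I] [DecidableEq J] [DecidableEq L] in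
/-- `symDist (c/d) = symCounts c / d³`. [folklore] -/
theorem symDist_counts (c : I × J × L → ℕ) {d : ℕ} (hd : 0 < d)
    (XYZ : (I × J × L) × (J × L × I) × (L × I × J)) :
    symDist (fun s => (c s : ℝ) / d) XYZ = (symCounts c XYZ : ℝ) / ((d ^ 3 : ℕ) : ℝ) := by
  have hd0 : (d : ℝ) ≠ 0 := by exact_mod_cast hd.ne'
  simp only [symDist, symCounts]
  push_cast
  field_simp

/-- **Types of the three factor words of a word of type `M · (c ⊗ c ⊗ c)`**: each factor word has
type `M d² · c` (`d = ∑ c`). [cite: LeGall2014, Appendix A.3 (Λ*: "(a,b,c), (a′,b′,c′) and (a″,b″,c″) are of type P")] -/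
theorem letterCount_proj_of_symCounts (c : I × J × L → ℕ) {d : ℕ} (hc : ∑ s, c s = d) {M N : ℕ}
    (w' : Fin N → (I × J × L) × (J × L × I) × (L × I × J))
    (hw' : letterCount w' = fun XYZ => M * symCounts c XYZ) :
    (letterCount (fun q => (symLabelEquiv I J L (w' q)).1) = fun s => M * d ^ 2 * c s) ∧
    (letterCount (fun q => (symLabelEquiv I J L (w' q)).2.1) = fun s => M * d ^ 2 * c s) ∧
    (letterCount (fun q => (symLabelEquiv I J L (w' q)).2.2) = fun s => M * d ^ 2 * c s) := by
  set wt : Fin N → (I × J × L) × (I × J × L) × (I × J × L) := fun q => symLabelEquiv I J L (w' q)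
    with hwt
  have hwt_count : ∀ T, letterCount wt T = M * (c T.1 * c T.2.1 * c T.2.2) := by
    intro T
    rw [hwt, letterCount_comp_equiv, hw']
    simp only [symCounts_symm_apply]
  refine ⟨funext fun s => ?_, funext fun s => ?_, funext fun s => ?_⟩
  · rw [show (fun q => (symLabelEquiv I J L (w' q)).1) = fun q => (wt q).1 from rfl, letterCount_fst]
    simp_rw [hwt_count]
    rw [show ∑ j : I × J × L, ∑ l : I × J × L, M * (c s * c j * c l) =
      M * c s * ((∑ j, c j) * ∑ l, c l) by
        rw [Finset.sum_mul_sum, Finset.mul_sum]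
        refine Finset.sum_congr rfl fun j _ => ?_
        rw [Finset.mul_sum]
        exact Finset.sum_congr rfl fun l _ => by ring, hc]
    ring
  · rw [show (fun q => (symLabelEquiv I J L (w' q)).2.1) = fun q => (wt q).2.1 from rfl,
      letterCount_snd_fst]
    simp_rw [hwt_count]
    rw [show ∑ i : I × J × L, ∑ l : I × J × L, M * (c i * c s * c l) =
      M * c s * ((∑ i, c i) * ∑ l, c l) by
        rw [Finset.sum_mul_sum, Finset.mul_sum]
        refine Finset.sum_congr rfl fun i _ => ?_
        rw [Finset.mul_sum]
        exact Finset.sum_congr rfl fun l _ => by ring, hc]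
    ring
  · rw [show (fun q => (symLabelEquiv I J L (w' q)).2.2) = fun q => (wt q).2.2 from rfl,
      letterCount_snd_snd]
    simp_rw [hwt_count]
    rw [show ∑ i : I × J × L, ∑ j : I × J × L, M * (c i * c j * c s) =
      M * c s * ((∑ i, c i) * ∑ j, c j) by
        rw [Finset.sum_mul_sum, Finset.mul_sum]
        refine Finset.sum_congr rfl fun i _ => ?_
        rw [Finset.mul_sum]
        exact Finset.sum_congr rfl fun j _ => by ring, hc]
    ring

/-- The product of component bounds along a word of type `K c` of length `N = dK` is the `N`-th
power of `∏_{s∈S} v(s)^{c(s)/d}`. [folklore] -/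
theorem prod_apply_word_eq_pow' (S : Finset (I × J × L)) (v : I × J × L → ℝ) (hv : ∀ s ∈ S, 0 < v s)
    (c : I × J × L → ℕ) (hcS : ∀ s, s ∉ S → c s = 0) {d : ℕ} (hd : 0 < d) {N K : ℕ} (hN : N = d * K)
    (w : Fin N → I × J × L) (hw : letterCount w = fun s => K * c s) :
    ∏ q, v (w q) = (∏ s ∈ S, v s ^ ((c s : ℝ) / d)) ^ N := by
  classical
  have hd0 : (d : ℝ) ≠ 0 := by exact_mod_cast hd.ne'
  rw [prod_apply_eq_prod_pow_letterCount v w, hw, ← Finset.prod_pow]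
  rw [← Finset.prod_subset (Finset.subset_univ S) (fun s _ hs => by
    simp only [hcS s hs, mul_zero, pow_zero])]
  refine Finset.prod_congr rfl fun s hs => ?_
  rw [← Real.rpow_natCast (v s ^ ((c s : ℝ) / d)) N, ← Real.rpow_mul (hv s hs).le,
    ← Real.rpow_natCast, hN]
  congr 1
  push_cast
  field_simp

end Counts

/-! ## The block value system of the induced decomposition -/

section Blocks

variable {K : Type u} [Field K]
variable {ι κ μ : Type*} [Fintype ι] [Fintype κ] [Fintype μ] [DecidableEq ι] [DecidableEq κ]
  [DecidableEq μ]
variable {I J L : Type*} [Fintype I] [Fintype J] [Fintype L] [DecidableEq I] [DecidableEq J]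
  [DecidableEq L]

/-- **The blocks of `(t ⊗ t_C ⊗ t_{C²})^{⊗N}` of type `M(c ⊗ c ⊗ c)` contain
`⊗_q (t(w₀(q)) ⊗ t(w₀(q))_C ⊗ t(w₀(q))_{C²})`** for any word `w₀` of type `M d² · c`
(Le Gall (6): `t̂(u,v,w) = t^{⊗N}(a,b,c) ⊗ t_C^{⊗N}(b′,c′,a′) ⊗ t_{C²}^{⊗N}(c″,a″,b″)` with
`(a,b,c), (a′,b′,c′), (a″,b″,c″)` of one type, and the permutation of coordinates aligning them).
[cite: LeGall2014, Appendix A.3, Eq. (6) and p. 24] -/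
theorem tensorRestrictsTo_laserBlock_symm3 (t : ι → κ → μ → K) (bI : ι → I) (bJ : κ → J)
    (bL : μ → L) (c : I × J × L → ℕ) {d : ℕ} (hc : ∑ s, c s = d) {M N : ℕ}
    (w' : Fin N → (I × J × L) × (J × L × I) × (L × I × J))
    (hw' : letterCount w' = fun XYZ => M * symCounts c XYZ)
    (w₀ : Fin N → I × J × L) (hw₀ : letterCount w₀ = fun s => M * d ^ 2 * c s) :
    TensorRestrictsTo (laserBlock (symLab₁ bI bJ bL) (symLab₂ bI bJ bL) (symLab₃ bI bJ bL) (symm3 t) w')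
      (kroneckerPi fun q =>
        symm3 (partSubtensor bI bJ bL t {(w₀ q).1} {(w₀ q).2.1} {(w₀ q).2.2})) := by
  classical
  obtain ⟨h1, h2, h3⟩ := letterCount_proj_of_symCounts c hc w' hw'
  set G := symLabelEquiv I J L with hG
  -- the components and the three factor words
  set comp : I × J × L → ι → κ → μ → K := fun s => partSubtensor bI bJ bL t {s.1} {s.2.1} {s.2.2}
    with hcomp
  set A : Fin N → ι → κ → μ → K := fun q => comp (G (w' q)).1 with hA
  set B : Fin N → κ → μ → ι → K := fun q => rotate (comp (G (w' q)).2.1) with hB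
  set C : Fin N → μ → ι → κ → K := fun q => rotate (rotate (comp (G (w' q)).2.2)) with hC
  -- (a) the block is `⊗_q (A_q ⊗ B_q ⊗ C_q)`
  have hblk : laserBlock (symLab₁ bI bJ bL) (symLab₂ bI bJ bL) (symLab₃ bI bJ bL) (symm3 t) w' =
      kroneckerPi fun q => kroneckerTensor (A q) (kroneckerTensor (B q) (C q)) := by
    simp only [laserBlock, hA, hB, hC, hcomp]
    congr 1
    funext q
    have hq : w' q = G.symm (G (w' q)) := (G.symm_apply_apply _).symm
    rw [hq]
    exact partSubtensor_symm3 t bI bJ bL (G (w' q))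
  rw [hblk]
  -- (b) split the Kronecker product of the family
  have hsplit1 : TensorRestrictsTo (kroneckerPi fun q => kroneckerTensor (A q) (kroneckerTensor (B q) (C q)))
      (kroneckerTensor (kroneckerPi A) (kroneckerPi fun q => kroneckerTensor (B q) (C q))) := by
    rw [kroneckerPi_kronecker_eq A (fun q => kroneckerTensor (B q) (C q))]
    exact tensorRestrictsTo_of_reindex _ _ _ _
  have hsplit2 : TensorRestrictsTo (kroneckerPi fun q => kroneckerTensor (B q) (C q))
      (kroneckerTensor (kroneckerPi B) (kroneckerPi C)) := by
    rw [kroneckerPi_kronecker_eq B C]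
    exact tensorRestrictsTo_of_reindex _ _ _ _
  -- (c)–(d) the three factors are (rotated) blocks of `t` of the type of `w₀`
  have hA' : TensorRestrictsTo (kroneckerPi A) (laserBlock bI bJ bL t w₀) :=
    tensorRestrictsTo_laserBlock_of_letterCount_eq bI bJ bL t (h1.trans hw₀.symm)
  have hB' : TensorRestrictsTo (kroneckerPi B) (rotate (laserBlock bI bJ bL t w₀)) := by
    rw [show kroneckerPi B = rotate (laserBlock bI bJ bL t fun q => (G (w' q)).2.1) from rfl]
    exact (tensorRestrictsTo_laserBlock_of_letterCount_eq bI bJ bL t (h2.trans hw₀.symm)).rotate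
  have hC' : TensorRestrictsTo (kroneckerPi C) (rotate (rotate (laserBlock bI bJ bL t w₀))) := by
    rw [show kroneckerPi C = rotate (rotate (laserBlock bI bJ bL t fun q => (G (w' q)).2.2)) from rfl]
    exact (tensorRestrictsTo_laserBlock_of_letterCount_eq bI bJ bL t (h3.trans hw₀.symm)).rotate.rotate
  -- (e) reassemble as `symm3` of the block and distribute over the family
  have hsymm : TensorRestrictsTo (kroneckerTensor (kroneckerPi A) (kroneckerTensor (kroneckerPi B) (kroneckerPi C)))
      (symm3 (laserBlock bI bJ bL t w₀)) :=
    hA'.kronecker (hB'.kronecker hC')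
  exact (((hsplit1.trans ((TensorRestrictsTo.refl _).kronecker hsplit2)).trans hsymm).trans
    (tensorRestrictsTo_symm3_kroneckerPi _))

/-- **The block value system**: if `V_ρ(t(s) ⊗ t(s)_C ⊗ t(s)_{C²}) ≥ u(s)³` on `S` (`u > 0`), then every
block of `(t ⊗ t_C ⊗ t_{C²})^{⊗ d³M}` of type `M (c ⊗ c ⊗ c)` has value `≥ (W³)^{d³M}`,
`W = ∏_{s∈S} u(s)^{c(s)/d}` (Le Gall: "`V_ρ(t̂(u,v,w)) ≥ (∏_s [V_ρ(t(s))]^{NP(s)})³` … since the value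
is supermultiplicative and invariant under permutation of coordinates").
[cite: LeGall2014, Appendix A.3 (p. 24)] -/
theorem hasLaserValue_laserBlock_symm3 (t : ι → κ → μ → K) (bI : ι → I) (bJ : κ → J) (bL : μ → L)
    (S : Finset (I × J × L)) {ρ : ℝ} (u : I × J × L → ℝ) (hu : ∀ s ∈ S, 0 < u s)
    (hval : ∀ s ∈ S, HasLaserValue ρ
      (symm3 (partSubtensor bI bJ bL t {s.1} {s.2.1} {s.2.2})) (u s ^ 3))
    (c : I × J × L → ℕ) (hcS : ∀ s, s ∉ S → c s = 0) {d : ℕ} (hd : 0 < d) (hc : ∑ s, c s = d)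
    {M : ℕ} (w' : Fin (d ^ 3 * M) → (I × J × L) × (J × L × I) × (L × I × J))
    (hw' : letterCount w' = fun XYZ => M * symCounts c XYZ) :
    HasLaserValue ρ
      (laserBlock (symLab₁ bI bJ bL) (symLab₂ bI bJ bL) (symLab₃ bI bJ bL) (symm3 t) w')
      (((∏ s ∈ S, u s ^ ((c s : ℝ) / d)) ^ 3) ^ (d ^ 3 * M)) := by
  classical
  -- a word of type `M d² c`
  have hsum : ∑ s, M * d ^ 2 * c s = d ^ 3 * M := by
    rw [← Finset.mul_sum, hc]; ring
  obtain ⟨w₀, hw₀⟩ := typeClass_nonempty (d ^ 3 * M) (fun s => M * d ^ 2 * c s) hsum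
  rw [mem_typeClass] at hw₀
  have hw₀S : ∀ q, w₀ q ∈ S := fun q => by
    by_contra h'
    have h0 : letterCount w₀ (w₀ q) = 0 := by rw [hw₀]; simp [hcS _ h']
    exact (letterCount_pos_of_apply w₀ q).ne' h0
  have hres := tensorRestrictsTo_laserBlock_symm3 t bI bJ bL c hc w' hw' w₀ hw₀
  have hkp := HasLaserValue.kroneckerPi (fun q => hval _ (hw₀S q))
    (fun q => pow_nonneg (hu _ (hw₀S q)).le 3)
  have heq : (∏ q, u (w₀ q) ^ 3) = ((∏ s ∈ S, u s ^ ((c s : ℝ) / d)) ^ 3) ^ (d ^ 3 * M) := by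
    rw [Finset.prod_pow, prod_apply_word_eq_pow' S u hu c hcS hd (K := M * d ^ 2) (by ring) w₀ hw₀,
      ← pow_mul, ← pow_mul, mul_comm]
  rw [heq] at hkp
  exact hkp.of_restrictsTo hres

end Blocks

/-! ## The theorem -/

section Main

variable {K : Type u} [Field K]
variable {ι κ μ : Type*} [Fintype ι] [Fintype κ] [Fintype μ] [DecidableEq ι] [DecidableEq κ]
  [DecidableEq μ]
variable {I J L : Type*} [Fintype I] [Fintype J] [Fintype L] [DecidableEq I] [DecidableEq J]
  [DecidableEq L]

/-- **Le Gall 2014, Thm. 4.1, for `P = c/d`, symmetrised form.**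
[cite: LeGall2014, Thm. 4.1 (proof, Appendix A.3)] -/
theorem laserMethodSym_hasLaserValue_of_counts (t : ι → κ → μ → K) (bI : ι → I) (bJ : κ → J)
    (bL : μ → L) (S : Finset (I × J × L)) (hS : ∀ a b c, t a b c ≠ 0 → (bI a, bJ b, bL c) ∈ S)
    {r b : ℕ} (α : I → Fin r → ℤ) (β : J → Fin r → ℤ) (γ : L → Fin r → ℤ)
    (hα : Function.Injective α) (hβ : Function.Injective β) (hγ : Function.Injective γ)
    (hαb : ∀ i k, |α i k| ≤ b) (hβb : ∀ j k, |β j k| ≤ b) (hγb : ∀ l k, |γ l k| ≤ b)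
    (htight : ∀ s ∈ S, ∀ k, α s.1 k + β s.2.1 k + γ s.2.2 k = 0)
    {ρ : ℝ} (u : I × J × L → ℝ) (hu : ∀ s ∈ S, 0 < u s)
    (hval : ∀ s ∈ S, HasLaserValue ρ
      (symm3 (partSubtensor bI bJ bL t {s.1} {s.2.1} {s.2.2})) (u s ^ 3))
    (c : I × J × L → ℕ) (hcS : ∀ s, s ∉ S → c s = 0) {d : ℕ} (hd : 0 < d) (hc : ∑ s, c s = d)
    (P : I × J × L → ℝ) (hP : ∀ s, P s = (c s : ℝ) / d) :
    HasLaserValue ρ (symm3 t) ((2 : ℝ) ^ (shannonEntropy (marginalDist₁ P) +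
        shannonEntropy (marginalDist₂ P) + shannonEntropy (marginalDist₃ P) -
        3 * maxEntropyPenalty S P) * (∏ s ∈ S, u s ^ P s) ^ 3) := by
  classical
  have hPfun : P = fun s => (c s : ℝ) / d := funext hP
  -- `P` is a distribution supported in `S`
  have hd0 : (d : ℝ) ≠ 0 := by exact_mod_cast hd.ne'
  have hP0 : ∀ s, 0 ≤ P s := fun s => by rw [hP]; positivity
  have hP1 : ∑ s, P s = 1 := by
    simp only [hP]; rw [← Finset.sum_div, ← Nat.cast_sum, hc, div_self hd0]
  have hPS : ∀ s, s ∉ S → P s = 0 := fun s hs => by simp [hP, hcS s hs]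
  -- the core on the induced decomposition
  set W : ℝ := ∏ s ∈ S, u s ^ P s with hW
  have hW0 : 0 < W := Finset.prod_pos fun s hs => Real.rpow_pos_of_pos (hu s hs) _
  have hd3 : 0 < d ^ 3 := pow_pos hd 3
  have hcore := laserMethod_hasLaserValue_of_blockValue (symm3 t) (symLab₁ bI bJ bL)
    (symLab₂ bI bJ bL) (symLab₃ bI bJ bL) (symSupport S) (symm3_support t bI bJ bL S hS)
    (symTight₁ α β γ) (symTight₂ α β γ) (symTight₃ α β γ)
    (symTight₁_injective hα hβ hγ) (symTight₂_injective hα hβ hγ) (symTight₃_injective hα hβ hγ)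
    (symTight₁_bound hαb hβb hγb) (symTight₂_bound hαb hβb hγb)
    (fun XYZ hXYZ k => symTight_sum S htight XYZ hXYZ k)
    (ρ := ρ) (symCounts c) (symCounts_eq_zero hcS) hd3
    (by rw [sum_symCounts, hc]) (symDist P)
    (fun XYZ => by rw [hPfun]; exact symDist_counts c hd XYZ) (pow_pos hW0 3)
    (fun M _ w' hw' => by
      have h := hasLaserValue_laserBlock_symm3 t bI bJ bL S u hu hval c hcS hd hc w' hw'
      simp only [← hP] at h
      rwa [← hW] at h)
  -- the marginal entropies and the penalty of the induced distribution
  obtain ⟨e1, e2, e3⟩ := shannonEntropy_marginalDist_symDist (P := P) hP1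
  have hpen := maxEntropyPenalty_symSupport_symDist_le S hP0 hP1 hPS
  refine hcore.mono (mul_nonneg (Real.rpow_nonneg zero_le_two _) (pow_nonneg hW0.le 3))
    (mul_le_mul_of_nonneg_right (Real.rpow_le_rpow_of_exponent_le one_le_two ?_) (pow_nonneg hW0.le 3))
  rw [e1, e2, e3, min_self, min_self]
  linarith

/-- **Le Gall 2014, Thm. 4.1 (the laser method with values and penalty, as printed).**  Let
`t : ι → κ → μ → K` be a tensor over a field with block labels `bI, bJ, bL`, `S ⊇ supp_D t` a
`b`-tight finite set of label triples (injective `α, β, γ : · → ℤ^r` bounded by `b` with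
`α i + β j + γ l = 0` on `S`), and suppose every component `t(s)` has Le Gall-value
`V_ρ(t(s)) ≥ u(s) > 0`, i.e. `HasLaserValue ρ (t(s) ⊗ t(s)_C ⊗ t(s)_{C²}) (u(s)³)`.  Then for every
probability distribution `P` on `S`,
`HasLaserValue ρ (t ⊗ t_C ⊗ t_{C²}) (2^{H(P₁)+H(P₂)+H(P₃) − 3Γ_S(P)} · (∏_{s∈S} u(s)^{P(s)})³)`, that is
`log₂ V_ρ(t) ≥ ∑_ℓ H(P_ℓ)/3 + ∑_s P(s) log₂ u(s) − Γ_S(P)` (`Γ_S = maxEntropyPenalty S`; no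
hypothesis `ρ ∈ [2,3]` is needed). [cite: LeGall2014, Thm. 4.1] -/
theorem laserMethodSym_hasLaserValue (t : ι → κ → μ → K) (bI : ι → I) (bJ : κ → J)
    (bL : μ → L) (S : Finset (I × J × L)) (hS : ∀ a b c, t a b c ≠ 0 → (bI a, bJ b, bL c) ∈ S)
    {r b : ℕ} (α : I → Fin r → ℤ) (β : J → Fin r → ℤ) (γ : L → Fin r → ℤ)
    (hα : Function.Injective α) (hβ : Function.Injective β) (hγ : Function.Injective γ)
    (hαb : ∀ i k, |α i k| ≤ b) (hβb : ∀ j k, |β j k| ≤ b) (hγb : ∀ l k, |γ l k| ≤ b)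
    (htight : ∀ s ∈ S, ∀ k, α s.1 k + β s.2.1 k + γ s.2.2 k = 0)
    {ρ : ℝ} (u : I × J × L → ℝ) (hu : ∀ s ∈ S, 0 < u s)
    (hval : ∀ s ∈ S, HasLaserValue ρ
      (symm3 (partSubtensor bI bJ bL t {s.1} {s.2.1} {s.2.2})) (u s ^ 3))
    (P : I × J × L → ℝ) (hP0 : ∀ s, 0 ≤ P s) (hP1 : ∑ s, P s = 1)
    (hPS : ∀ s, s ∉ S → P s = 0) :
    HasLaserValue ρ (symm3 t) ((2 : ℝ) ^ (shannonEntropy (marginalDist₁ P) +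
        shannonEntropy (marginalDist₂ P) + shannonEntropy (marginalDist₃ P) -
        3 * maxEntropyPenalty S P) * (∏ s ∈ S, u s ^ P s) ^ 3) := by
  classical
  -- the functionals
  set Hs : (I × J × L → ℝ) → ℝ := fun P' => shannonEntropy (marginalDist₁ P') +
    shannonEntropy (marginalDist₂ P') + shannonEntropy (marginalDist₃ P') with hHs
  set Wf : (I × J × L → ℝ) → ℝ := fun P' => ∏ s ∈ S, u s ^ P' s with hWf
  set Φc : (I × J × L → ℝ) → ℝ := fun P' => (2 : ℝ) ^ (Hs P' + 3 * shannonEntropy P') * Wf P' ^ 3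
    with hΦc
  have hfactor : ∀ P' : I × J × L → ℝ, (2 : ℝ) ^ (Hs P' - 3 * maxEntropyPenalty S P') * Wf P' ^ 3 =
      Φc P' * (2 : ℝ) ^ (-(3 * maxEntropyGivenMarginals S P')) := by
    intro P'
    simp only [hΦc, maxEntropyPenalty]
    rw [mul_right_comm, ← Real.rpow_add two_pos]
    ring_nf
  have hWf0 : ∀ P', 0 < Wf P' := fun P' => Finset.prod_pos fun s hs => Real.rpow_pos_of_pos (hu s hs) _
  have hcontΦ : Continuous Φc := by
    have h1 : Continuous Hs := by
      simp only [hHs]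
      exact ((continuous_shannonEntropy.comp continuous_marginalDist₁).add
        (continuous_shannonEntropy.comp continuous_marginalDist₂)).add
          (continuous_shannonEntropy.comp continuous_marginalDist₃)
    have h2 : Continuous Wf := by
      simp only [hWf]
      exact continuous_finsetProd _ fun s hs =>
        (Real.continuous_const_rpow (hu s hs).ne').comp (continuous_apply s)
    simp only [hΦc]
    exact ((Real.continuous_const_rpow two_ne_zero).comp
      (h1.add (continuous_const.mul continuous_shannonEntropy))).mul (h2.pow 3)
  have hΦ0 : ∀ P', 0 ≤ Φc P' := fun P' =>
    mul_nonneg (Real.rpow_nonneg zero_le_two _) (pow_nonneg (hWf0 P').le 3)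
  have hrat : ∀ (c : I × J × L → ℕ) (d : ℕ), 0 < d → ∑ s, c s = d → (∀ s, s ∉ S → c s = 0) →
      HasLaserValue ρ (symm3 t) (Φc (fun s => (c s : ℝ) / d) *
        (2 : ℝ) ^ (-(3 * maxEntropyGivenMarginals S fun s => (c s : ℝ) / d))) := by
    intro c d hd hc hcS
    rw [← hfactor]
    exact laserMethodSym_hasLaserValue_of_counts t bI bJ bL S hS α β γ hα hβ hγ hαb hβb hγb htight u
      hu hval c hcS hd hc _ fun _ => rfl
  have h := hasLaserValue_of_rational_approx (symm3 t) S Φc hcontΦ hΦ0 (by norm_num : (0 : ℝ) ≤ 3)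
    hrat P hP0 hP1 hPS
  rwa [← hfactor] at h

/-- **Corollary (Le Gall Thm. 2.2 with Thm. 4.1): the bound on `ω`.**  In the setting of
`laserMethodSym_hasLaserValue`, if `2^{∑_ℓ H(P_ℓ) − 3Γ_S(P)} (∏_s u(s)^{P(s)})³ > R̃(t)³` and
`ρ > 0` then `ω ≤ ρ` (`R̃(t ⊗ t_C ⊗ t_{C²}) ≤ R̃(t)³`). [cite: LeGall2014, Thm. 2.2 and Thm. 4.1] -/
theorem omega_le_of_laserMethodSym (t : ι → κ → μ → K) (bI : ι → I) (bJ : κ → J)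
    (bL : μ → L) (S : Finset (I × J × L)) (hS : ∀ a b c, t a b c ≠ 0 → (bI a, bJ b, bL c) ∈ S)
    {r b : ℕ} (α : I → Fin r → ℤ) (β : J → Fin r → ℤ) (γ : L → Fin r → ℤ)
    (hα : Function.Injective α) (hβ : Function.Injective β) (hγ : Function.Injective γ)
    (hαb : ∀ i k, |α i k| ≤ b) (hβb : ∀ j k, |β j k| ≤ b) (hγb : ∀ l k, |γ l k| ≤ b)
    (htight : ∀ s ∈ S, ∀ k, α s.1 k + β s.2.1 k + γ s.2.2 k = 0)
    {ρ : ℝ} (hρ : 0 < ρ) (u : I × J × L → ℝ) (hu : ∀ s ∈ S, 0 < u s)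
    (hval : ∀ s ∈ S, HasLaserValue ρ
      (symm3 (partSubtensor bI bJ bL t {s.1} {s.2.1} {s.2.2})) (u s ^ 3))
    (P : I × J × L → ℝ) (hP0 : ∀ s, 0 ≤ P s) (hP1 : ∑ s, P s = 1)
    (hPS : ∀ s, s ∉ S → P s = 0)
    (hbig : asymptoticRank t ^ 3 < (2 : ℝ) ^ (shannonEntropy (marginalDist₁ P) +
        shannonEntropy (marginalDist₂ P) + shannonEntropy (marginalDist₃ P) -
        3 * maxEntropyPenalty S P) * (∏ s ∈ S, u s ^ P s) ^ 3) :
    omega K ≤ ρ :=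
  omega_le_of_hasLaserValue hρ (laserMethodSym_hasLaserValue t bI bJ bL S hS α β γ hα hβ hγ hαb hβb
    hγb htight u hu hval P hP0 hP1 hPS) ((asymptoticRank_symm3_le t).trans_lt hbig)

end Main

/-! ## The Le Gall value of matrix tensors -/

section MatMul

variable (K : Type u) [Field K]

/-- `⟨k,m,n⟩_C` is the matrix tensor `⟨m,n,k⟩` up to swapping coordinates (Bläser 2013, p. 22).
[cite: Blaser2013, Lemma 5.5 (proof)] -/
theorem tensorRestrictsTo_rotate_matMulTensor (k m n : ℕ) :
    TensorRestrictsTo (rotate (matMulTensor K k m n)) (matMulTensor K m n k) := by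
  have : rotate (matMulTensor K k m n) = fun b c a =>
      matMulTensor K m n k (Equiv.prodComm _ _ b) (Equiv.refl _ c) (Equiv.prodComm _ _ a) := by
    funext b c a
    rw [rotate_apply, matMulTensor_rotate]
    rfl
  rw [this]
  exact tensorRestrictsTo_of_reindex _ _ _ _

/-- **`V_ρ(⟨k,m,n⟩) ≥ (kmn)^{ρ/3}` in Le Gall's sense**: `⟨k,m,n⟩ ⊗ ⟨k,m,n⟩_C ⊗ ⟨k,m,n⟩_{C²}` has value
`≥ ((kmn)^{ρ/3})³` (the three factors are matrix tensors of volume `kmn`; Le Gall: "By definition,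
for any positive integers `m,n,p` we have `V_ρ(⟨m,n,p⟩) ≥ (mnp)^{ρ/3}`").
[cite: LeGall2014, §2.2] -/
theorem hasLaserValue_symm3_matMulTensor (ρ : ℝ) (k m n : ℕ) :
    HasLaserValue ρ (symm3 (matMulTensor K k m n)) ((((k * m * n : ℕ) : ℝ) ^ (ρ / 3)) ^ 3) := by
  classical
  have h0 : (0 : ℝ) ≤ ((k * m * n : ℕ) : ℝ) ^ (ρ / 3) := Real.rpow_nonneg (Nat.cast_nonneg _) _
  have h1 := hasLaserValue_matMulTensor K ρ k m n
  have h2 : HasLaserValue ρ (rotate (matMulTensor K k m n)) (((k * m * n : ℕ) : ℝ) ^ (ρ / 3)) := by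
    have := hasLaserValue_matMulTensor K ρ m n k
    rw [show m * n * k = k * m * n by ring] at this
    exact this.of_restrictsTo (tensorRestrictsTo_rotate_matMulTensor K k m n)
  have h3 : HasLaserValue ρ (rotate (rotate (matMulTensor K k m n)))
      (((k * m * n : ℕ) : ℝ) ^ (ρ / 3)) := by
    have := hasLaserValue_matMulTensor K ρ n k m
    rw [show n * k * m = k * m * n by ring] at this
    exact this.of_restrictsTo ((tensorRestrictsTo_rotate_matMulTensor K k m n).rotate.trans
      (tensorRestrictsTo_rotate_matMulTensor K m n k))
  have h := h1.kronecker (h2.kronecker h3 h0 h0) h0 (mul_nonneg h0 h0)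
  rw [show (((k * m * n : ℕ) : ℝ) ^ (ρ / 3)) ^ 3 = ((k * m * n : ℕ) : ℝ) ^ (ρ / 3) *
    (((k * m * n : ℕ) : ℝ) ^ (ρ / 3) * ((k * m * n : ℕ) : ℝ) ^ (ρ / 3)) by ring]
  exact h

end MatMul

end Literature.Computability.AlgebraicComplexity
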